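import Literature.NumberTheory.Automorphic.MatrixCoeffGrowthGL
import Literature.NumberTheory.Automorphic.GodementJacquetLocalNonvanishing
import Mathlib.MeasureTheory.Integral.Lebesgue.Countable
import Mathlib.Analysis.SpecialFunctions.Pow.Real
import HarnessLib

/-!
# Convergence of the local Godement–Jacquet zeta integrals (Godement–Jacquet (1972),
Thm. 3.3 (1)): discharge of `GodementJacquet1972_local_convergence`

Topic `NumberTheory/Automorphic`; theorems only. This file proves the named fact
`Literature.NumberTheory.Automorphic.GodementJacquet1972_local_convergence` of
`GodementJacquetLocal`: for an irreducible admissible representation `π` of `GL_n(F)` (`F` a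
non-archimedean local field) and a Haar measure `μG` on `GL_n(F)` there is `s₀ ∈ ℝ` such that the
local zeta integrals `Z(Φ, s, f) = ∫ Φ(x) f(x) |det x|^s dμG(x)` converge absolutely for every
Schwartz–Bruhat `Φ` on `M_n(F)`, every coefficient `f(g) = ⟨π(g) v, ṽ⟩` (`ṽ` in the smooth
contragredient) and `re s > s₀` (Godement–Jacquet, LNM 260 (1972), Thm. 3.3 (1); Jacquet,
Corvallis (1979), Part 2, Prop. (1.2)(1)).

## Proof

The printed proof (LNM 260, §2–§3) goes through the supercuspidal support of `π` and coefficients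
of induced representations. Here the argument is elementary:

1. *Reduction to one coefficient* (`GodementJacquet1972_local_convergence_holds`): every
   non-zero vector of an irreducible representation is cyclic
   (`exists_finsupp_sum_smul_apply_eq`), for `V` and for the contragredient `Ṽ`
   (`Representation.isIrreducible_contragredient_holds`; `GL_n(F)` is nonarchimedean, locally
   compact and Hausdorff), so every coefficient `⟨π(x) v, ṽ⟩` is a finite combination of
   two-sided translates `⟨π(h⁻¹ x g) v₀, ṽ₀⟩` of one coefficient with `v₀ ≠ 0` of level `K_m`
   (`m ≥ 2`) and `ṽ₀` a `K_m`-fixed smooth linear form.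
2. *The core estimate* (`exists_integrable_coeff_translate`): `Φ` is bounded and supported in
   `ϖ^{-r} M_n(𝒪) = ⋃_d ϖ^{-r} Δ_d` (`exists_isIntegralMatrix_smul_of_hasCompactSupport`); on
   `ϖ^{-r} Δ_d` the translated coefficient is `O(M^d)` (`exists_norm_coeff_le_of_mem_glIntDet`
   of `MatrixCoeffGrowthGL`: Cartan decomposition and Hecke multiplicativity at level `K_m`),
   `|det x| = |ϖ|^{d - rn}` and `μG(ϖ^{-r} Δ_d) = μG(Δ_d) ≤ #(Δ_d K/K) μG(K) ≤ D^d μG(K)`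
   (`measure_glIntDet_le`, `card_cosets_glIntDet_le_pow`); only left invariance of `μG` is used.
   Hence `∫ |Φ f| |det|^{re s} ≤ c ∑_d (M D |ϖ|^{re s})^d < ∞` as soon as
   `re s > s₀ = log (M D) / log |ϖ|⁻¹`.

## References

* R. Godement, H. Jacquet, *Zeta functions of simple algebras*, LNM 260 (1972), §3, Thm. 3.3 (1)
  [GodementJacquet1972] (not held; statement as recorded in `GodementJacquetLocal`).
* H. Jacquet, *Principal `L`-functions of the linear group*, Proc. Sympos. Pure Math. 33 (1979),
  Part 2, §1, Prop. (1.2)(1) [JacquetCorvallis1979].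
* W. Casselman, *Introduction to the theory of admissible representations of 𝔭-adic reductive
  groups* (1995 notes), §4 (growth of matrix coefficients).
-/

set_option autoImplicit false

noncomputable section

open scoped MatrixGroups Matrix NNReal ENNReal
open Matrix ValuativeRel

namespace Literature.NumberTheory.Automorphic

/-! ### Integrability of the local zeta integrals -/

section Integrability

open _root_.MeasureTheory _root_.Topology Filter
  Literature.NumberTheory.GaloisRepresentations.IsNonarchimedeanLocalField

variable {F : Type*} [Field F] [ValuativeRel F] {n : ℕ} {ϖ : F} [TopologicalSpace F]
  [IsNonarchimedeanLocalField F]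

omit [IsNonarchimedeanLocalField F] in
/-- A compactly supported function on `M_n(F)` is supported in `ϖ^{-r} M_n(𝒪)` for some `r`
(the compact support is covered by the increasing open sets `ϖ^{-r} M_n(𝒪)`). [folklore] -/
theorem exists_isIntegralMatrix_smul_of_hasCompactSupport [IsValuativeTopology F]
    [IsDiscreteValuationRing 𝒪[F]] (hϖ : IsUniformizingElement ϖ)
    {E : Type*} [Zero E] {Φ : Matrix (Fin n) (Fin n) F → E} (hΦ : HasCompactSupport Φ) :
    ∃ r : ℕ, ∀ X, Φ X ≠ 0 → IsIntegralMatrix (ϖ ^ r • X) := by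
  classical
  set U : ℕ → Set (Matrix (Fin n) (Fin n) F) := fun r => {X | ∀ i j, ϖ ^ r * X i j ∈ 𝒪[F]} with hU
  have hUo : ∀ r, IsOpen (U r) := by
    intro r
    have e : U r = ⋂ i, ⋂ j, (fun X : Matrix (Fin n) (Fin n) F => ϖ ^ r * X i j) ⁻¹'
        (𝒪[F] : Set F) := by
      ext X; simp [hU]
    rw [e]
    exact isOpen_iInter_of_finite fun i => isOpen_iInter_of_finite fun j =>
      (Valuation.isOpen_integer (v := valuation F)).preimage
        (continuous_const.mul (continuous_id.matrix_elem i j))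
  have hUmono : ∀ r r', r ≤ r' → U r ⊆ U r' := by
    intro r r' h X hX i j
    have e : ϖ ^ r' * X i j = ϖ ^ (r' - r) * (ϖ ^ r * X i j) := by
      rw [← mul_assoc, ← pow_add, Nat.sub_add_cancel h]
    rw [e]
    exact Subring.mul_mem _ (hϖ.pow_mem _) (hX i j)
  have hcover : tsupport Φ ⊆ ⋃ r, U r := by
    intro X _
    choose N hN using fun p : Fin n × Fin n => exists_pow_mul_mem hϖ (X p.1 p.2)
    refine Set.mem_iUnion.mpr ⟨Finset.univ.sup N, fun i j => hN (i, j) _ ?_⟩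
    exact Finset.le_sup (f := N) (Finset.mem_univ (i, j))
  obtain ⟨t, ht⟩ := hΦ.elim_finite_subcover U hUo hcover
  refine ⟨t.sup id, fun X hX i j => ?_⟩
  have hXt : X ∈ ⋃ r ∈ t, U r := ht (subset_tsupport Φ (Function.mem_support.mpr hX))
  obtain ⟨r, hr, hXr⟩ := Set.mem_iUnion₂.mp hXt
  rw [Matrix.smul_apply, smul_eq_mul]
  exact hUmono r _ (Finset.le_sup (f := id) hr) hXr i j

variable [MeasurableSpace (GL (Fin n) F)] [BorelSpace (GL (Fin n) F)]

omit [BorelSpace (GL (Fin n) F)] in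
/-- **`μ(Δ_m) ≤ #(Δ_m K / K) · μ(K)`** for a left-invariant measure: `Δ_m` is contained in the
union of its finitely many left `K`-cosets, each of measure `μ(K)`. [folklore] -/
theorem measure_glIntDet_le (hϖ : IsUniformizingElement ϖ) (μ : Measure (GL (Fin n) F))
    [μ.IsMulLeftInvariant] (m : ℕ) :
    μ (glIntDet n ϖ m) ≤ (finite_cosets_glIntDet (n := n) hϖ m).toFinset.card * μ (glInt n F) := by
  classical
  have hsub : glIntDet n ϖ m ⊆ ⋃ γ ∈ (finite_cosets_glIntDet (n := n) hϖ m).toFinset,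
      {x : GL (Fin n) F | (x : GL (Fin n) F ⧸ glInt n F) = γ} := by
    intro x hx
    refine Set.mem_iUnion₂.mpr ⟨(x : GL (Fin n) F ⧸ glInt n F), ?_, rfl⟩
    rw [Set.Finite.mem_toFinset, Set.mem_setOf_eq]
    exact (mk_out_mem_glIntDet_iff x).mpr hx
  calc μ (glIntDet n ϖ m)
      ≤ μ (⋃ γ ∈ (finite_cosets_glIntDet (n := n) hϖ m).toFinset,
          {x : GL (Fin n) F | (x : GL (Fin n) F ⧸ glInt n F) = γ}) := measure_mono hsub
    _ ≤ ∑ γ ∈ (finite_cosets_glIntDet (n := n) hϖ m).toFinset,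
          μ {x : GL (Fin n) F | (x : GL (Fin n) F ⧸ glInt n F) = γ} :=
        measure_biUnion_finset_le _ _
    _ = (finite_cosets_glIntDet (n := n) hϖ m).toFinset.card * μ (glInt n F) := by
        simp_rw [measure_setOf_mk_eq]
        rw [Finset.sum_const, nsmul_eq_mul]

omit [MeasurableSpace (GL (Fin n) F)] [BorelSpace (GL (Fin n) F)] in
/-- On `ϖ^{-r} Δ_m`, `|det x| = |ϖ|^m / |ϖ|^{rn}`. [folklore] -/
theorem normAbs_det_of_zpowDiagGL_const_mul_mem (hϖ : IsUniformizingElement ϖ) {r m : ℕ}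
    {x : GL (Fin n) F} (hx : zpowDiagGL hϖ.ne_zero (fun _ : Fin n => (r : ℤ)) * x ∈ glIntDet n ϖ m) :
    normAbs F ((Matrix.GeneralLinearGroup.det x : Fˣ) : F) * normAbs F ϖ ^ (r * n) =
      normAbs F ϖ ^ m := by
  have h := normAbs_det_of_mem_glIntDet hx
  rw [map_mul, Units.val_mul, map_mul, Matrix.GeneralLinearGroup.val_det_apply, coe_zpowDiagGL,
    Matrix.det_diagonal, Finset.prod_const, Finset.card_univ, Fintype.card_fin, zpow_natCast,
    ← pow_mul, map_pow, mul_comm] at h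
  exact h

/-- **Integrability of two-sided translates of one coefficient (the core estimate).** Let `ρ`
be smooth with `V^{K_m}` finite-dimensional (`m ≥ 2`), `v₀ ∈ V^{K_m}`, `φ₀ ∈ Ṽ^{K_m}`, and `μ`
a left-invariant measure on `GL_n(F)` finite on compacts. There is `s₀` such that for all
`g₁, g₂ ∈ GL_n(F)`, all Schwartz–Bruhat `Φ` on `M_n(F)` and `re s > s₀`, the function
`x ↦ Φ(x) φ₀(ρ(g₁ x g₂) v₀) |det x|^s` is integrable. Proof: `Φ` is bounded and supported in
`ϖ^{-r} M_n(𝒪) = ⋃_d ϖ^{-r} Δ_d`; on `ϖ^{-r} Δ_d` the coefficient is `O(M^d)`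
(`exists_norm_coeff_le_of_mem_glIntDet`, the translations `g₁, g₂ ∈ ϖ^{-N_i} Δ_{m_i}` shifting
`d` by constants), `|det x|^{re s} = |ϖ|^{(d - rn) re s}` and
`μ(ϖ^{-r} Δ_d) = μ(Δ_d) ≤ D^d μ(K)` (`measure_glIntDet_le`, `card_cosets_glIntDet_le_pow`), so
the integral is dominated by `∑_d (M D |ϖ|^{re s})^d < ∞` once `|ϖ|^{-re s} > M D`. [folklore] -/
theorem exists_integrable_coeff_translate (hϖ : IsUniformizingElement ϖ) {m : ℕ} (hm : 2 ≤ m)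
    {V : Type*} [AddCommGroup V] [Module ℂ V] (ρ : Representation ℂ (GL (Fin n) F) V)
    (hρ : ρ.IsSmooth) [Module.Finite ℂ (ρ.fixedPoints (congruenceGL n (valuation F ϖ ^ m)))]
    {v₀ : V} (hv₀ : v₀ ∈ ρ.fixedPoints (congruenceGL n (valuation F ϖ ^ m)))
    {φ₀ : Module.Dual ℂ V} (hφ₀ : φ₀ ∈ ρ.contragredient)
    (hφ₀K : ∀ g ∈ congruenceGL n (valuation F ϖ ^ m), ρ.dual g φ₀ = φ₀)
    (μ : Measure (GL (Fin n) F)) [μ.IsMulLeftInvariant] [IsFiniteMeasureOnCompacts μ] :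
    ∃ s₀ : ℝ, ∀ (g₁ g₂ : GL (Fin n) F), ∀ Φ ∈ SchwartzBruhat (Matrix (Fin n) (Fin n) F), ∀ s : ℂ,
      s₀ < s.re → Integrable (fun x : GL (Fin n) F => Φ x * φ₀ (ρ (g₁ * x * g₂) v₀) *
        ((((normAbs F ((Matrix.GeneralLinearGroup.det x : Fˣ) : F)) : ℝ≥0) : ℝ) : ℂ) ^ s) μ := by
  classical
  obtain ⟨M, hM1, C, hC0, hC⟩ := exists_norm_coeff_le_of_mem_glIntDet hϖ hm ρ hρ hv₀ hφ₀ hφ₀K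
  -- the coset count base `D ≥ 1` and `t = |ϖ| ∈ (0, 1)`
  set Dc : ℕ := (MulAction.orbit (glInt n F) ((heckeDiag n (Units.mk0 ϖ hϖ.ne_zero) 1 :
    GL (Fin n) F) : GL (Fin n) F ⧸ glInt n F)).ncard with hDc
  have hDc1 : 1 ≤ Dc := (one_le_ncard_orbit_heckeDiag_one hϖ).2
  set t : ℝ := ((normAbs F ϖ : ℝ≥0) : ℝ) with ht
  have ht0 : 0 < t := by
    rw [ht]
    exact_mod_cast (zero_lt_iff.mpr ((map_ne_zero (normAbs F)).mpr hϖ.ne_zero))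
  have ht1 : t < 1 := by
    rw [ht]
    exact_mod_cast (normAbs_lt_one_iff.mpr hϖ.valuation_lt_one)
  have hMD : 0 < M * Dc := mul_pos (zero_lt_one.trans_le hM1) (by exact_mod_cast hDc1)
  refine ⟨Real.log (M * Dc) / Real.log t⁻¹, fun g₁ g₂ Φ hΦ s hs => ?_⟩
  set σ : ℝ := s.re with hσ
  -- the ratio `q = M D t^σ < 1`
  have hlog : 0 < Real.log t⁻¹ := Real.log_pos (one_lt_inv₀ ht0 |>.mpr ht1)
  have hq : M * Dc * t ^ σ < 1 := by
    have h1 : Real.log (M * Dc) < σ * Real.log t⁻¹ := (div_lt_iff₀ hlog).mp hs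
    have h2 : M * Dc < t⁻¹ ^ σ := (Real.lt_rpow_iff_log_lt hMD (inv_pos.mpr ht0)).mpr h1
    rw [Real.inv_rpow ht0.le] at h2
    have h3 := mul_lt_mul_of_pos_right h2 (Real.rpow_pos_of_pos ht0 σ)
    rwa [inv_mul_cancel₀ (Real.rpow_pos_of_pos ht0 σ).ne'] at h3
  have htσ : 0 < t ^ σ := Real.rpow_pos_of_pos ht0 σ
  -- positions of `g₁`, `g₂`, the support radius `r` of `Φ` and its bound `B`
  obtain ⟨N₁, m₁, hg₁⟩ := exists_zpowDiagGL_const_mul_mem_glIntDet hϖ g₁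
  obtain ⟨N₂, m₂, hg₂⟩ := exists_zpowDiagGL_const_mul_mem_glIntDet hϖ g₂
  obtain ⟨r, hr⟩ := exists_isIntegralMatrix_smul_of_hasCompactSupport hϖ hΦ.2
  obtain ⟨B, hB⟩ := hΦ.1.continuous.bounded_above_of_compact_support hΦ.2
  have hB0 : 0 ≤ B := (norm_nonneg _).trans (hB 0)
  set z : ℕ → GL (Fin n) F := fun N => zpowDiagGL hϖ.ne_zero (fun _ : Fin n => (N : ℤ)) with hz
  set R : ℕ := N₁ + r + N₂ with hR
  -- the pieces `S_d = ϖ^{-r} Δ_d`, open, of measure `μ(Δ_d) ≤ D^d μ(K)`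
  set S : ℕ → Set (GL (Fin n) F) := fun d => (fun x => z r * x) ⁻¹' glIntDet n ϖ d with hS
  have hSopen : ∀ d, IsOpen (S d) := fun d => by
    have h : IsOpen {x : GL (Fin n) F | x ∈ glIntDet n ϖ d} := by
      rw [setOf_mem_glIntDet_eq]; exact isOpen_setOf_mk_mem _
    exact h.preimage (continuous_const.mul continuous_id)
  have hSmeas : ∀ d, MeasurableSet (S d) := fun d => (hSopen d).measurableSet
  have hμS : ∀ d, μ (S d) ≤ (Dc : ℝ≥0∞) ^ d * μ (glInt n F) := fun d => by
    rw [hS]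
    dsimp only
    rw [measure_preimage_mul]
    refine (measure_glIntDet_le hϖ μ d).trans ?_
    gcongr
    exact_mod_cast card_cosets_glIntDet_le_pow hϖ d
  have hμK : μ (glInt n F) < ⊤ := (isCompact_glInt n F).measure_lt_top
  -- the constant `K₀` and the per-piece bounds
  set w₀ : ℝ := (t ^ (r * n))⁻¹ ^ σ with hw₀
  have hw₀0 : 0 < w₀ := Real.rpow_pos_of_pos (inv_pos.mpr (pow_pos ht0 _)) σ
  set K₀ : ℝ := B * (C * M ^ (m₁ + m₂ + n * R)) * w₀ with hK₀
  have hK₀0 : 0 ≤ K₀ := mul_nonneg (mul_nonneg hB0 (mul_nonneg hC0 (pow_nonneg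
    (zero_le_one.trans hM1) _))) hw₀0.le
  set f : GL (Fin n) F → ℂ := fun x => Φ x * φ₀ (ρ (g₁ * x * g₂) v₀) *
    ((((normAbs F ((Matrix.GeneralLinearGroup.det x : Fˣ) : F)) : ℝ≥0) : ℝ) : ℂ) ^ s with hf
  -- pointwise bound on `S_d`
  have hptw : ∀ d, ∀ x ∈ S d, ‖f x‖ ≤ K₀ * (M * t ^ σ) ^ d := by
    intro d x hx
    have hx' : z r * x ∈ glIntDet n ϖ d := hx
    -- the coefficient
    have hy : z R * (g₁ * x * g₂) ∈ glIntDet n ϖ (m₁ + d + m₂) := by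
      have hc : ∀ (y : GL (Fin n) F) (c : ℕ), y * z c = z c * y := fun y c =>
        mul_zpowDiagGL_const_comm hϖ.ne_zero _ y
      have hzR : z R = z N₁ * z r * z N₂ := by
        simp only [hz, hR, zpowDiagGL_const_mul_const, Nat.cast_add]
      have e : z R * (g₁ * x * g₂) = (z N₁ * g₁) * (z r * x) * (z N₂ * g₂) := by
        rw [hzR]
        symm
        calc (z N₁ * g₁) * (z r * x) * (z N₂ * g₂) = z N₁ * (g₁ * z r) * x * (z N₂ * g₂) := by group
          _ = z N₁ * (z r * g₁) * x * (z N₂ * g₂) := by rw [hc g₁ r]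
          _ = z N₁ * z r * (g₁ * x * z N₂) * g₂ := by group
          _ = z N₁ * z r * (z N₂ * (g₁ * x)) * g₂ := by rw [hc (g₁ * x) N₂]
          _ = z N₁ * z r * z N₂ * (g₁ * x * g₂) := by group
      rw [e]
      exact mul_mem_glIntDet (mul_mem_glIntDet hg₁ hx') hg₂
    have hcoef : ‖φ₀ (ρ (g₁ * x * g₂) v₀)‖ ≤ C * M ^ (m₁ + m₂ + n * R) * M ^ d := by
      refine (hC R _ _ hy).trans (le_of_eq ?_)
      rw [mul_assoc, ← pow_add]
      congr 2; ring
    -- the determinant factor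
    have hdet : normAbs F ((Matrix.GeneralLinearGroup.det x : Fˣ) : F) * normAbs F ϖ ^ (r * n) =
        normAbs F ϖ ^ d := normAbs_det_of_zpowDiagGL_const_mul_mem hϖ hx'
    have hdetR : ((normAbs F ((Matrix.GeneralLinearGroup.det x : Fˣ) : F) : ℝ≥0) : ℝ) =
        t ^ d * (t ^ (r * n))⁻¹ := by
      rw [eq_mul_inv_iff_mul_eq₀ (pow_ne_zero _ ht0.ne'), ht, ← NNReal.coe_pow, ← NNReal.coe_pow,
        ← NNReal.coe_mul, hdet]
    have hdpos : 0 < ((normAbs F ((Matrix.GeneralLinearGroup.det x : Fˣ) : F) : ℝ≥0) : ℝ) := by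
      rw [hdetR]; exact mul_pos (pow_pos ht0 _) (inv_pos.mpr (pow_pos ht0 _))
    have hcpow : ‖((((normAbs F ((Matrix.GeneralLinearGroup.det x : Fˣ) : F)) : ℝ≥0) : ℝ) : ℂ) ^ s‖
        = (t ^ σ) ^ d * w₀ := by
      rw [Complex.norm_cpow_eq_rpow_re_of_pos hdpos, hdetR,
        Real.mul_rpow (pow_nonneg ht0.le _) (inv_nonneg.mpr (pow_nonneg ht0.le _)), hw₀, ← hσ]
      congr 1
      rw [← Real.rpow_natCast, ← Real.rpow_mul ht0.le, mul_comm, Real.rpow_mul ht0.le,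
        Real.rpow_natCast]
    -- assemble
    rw [hf]
    dsimp only
    rw [norm_mul, norm_mul, hcpow]
    calc ‖Φ x‖ * ‖φ₀ (ρ (g₁ * x * g₂) v₀)‖ * ((t ^ σ) ^ d * w₀)
        ≤ B * (C * M ^ (m₁ + m₂ + n * R) * M ^ d) * ((t ^ σ) ^ d * w₀) :=
          mul_le_mul_of_nonneg_right (mul_le_mul (hB _) hcoef (norm_nonneg _) hB0)
            (mul_nonneg (pow_nonneg htσ.le _) hw₀0.le)
      _ = K₀ * (M * t ^ σ) ^ d := by rw [hK₀, mul_pow]; ring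
  -- `f` vanishes off `⋃_d S_d`
  have hzero : ∀ x, (∀ d, x ∉ S d) → f x = 0 := by
    intro x hx
    have hΦ0 : Φ x = 0 := by
      by_contra h
      have hint : IsIntegralMatrix ((z r * x : GL (Fin n) F) : Matrix (Fin n) (Fin n) F) :=
        (isIntegralMatrix_zpowDiagGL_const_mul_iff hϖ.ne_zero r x).mpr (hr _ h)
      obtain ⟨d, hd⟩ := exists_mem_glIntDet hϖ hint
      exact hx d hd
    simp [hf, hΦ0]
  -- domination by a summable simple function
  set c : ℕ → ℝ≥0∞ := fun d => ENNReal.ofReal (K₀ * (M * t ^ σ) ^ d) with hc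
  have hdom : ∀ x, ‖f x‖ₑ ≤ ∑' d, (S d).indicator (fun _ => c d) x := by
    intro x
    by_cases hx : ∃ d, x ∈ S d
    · obtain ⟨d, hd⟩ := hx
      calc ‖f x‖ₑ = ENNReal.ofReal ‖f x‖ := (ofReal_norm _).symm
        _ ≤ c d := ENNReal.ofReal_le_ofReal (hptw d x hd)
        _ = (S d).indicator (fun _ => c d) x := by rw [Set.indicator_of_mem hd]
        _ ≤ ∑' d, (S d).indicator (fun _ => c d) x := ENNReal.le_tsum d
    · push Not at hx
      rw [hzero x hx, enorm_zero]
      exact bot_le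
  -- measurability: the integrand is continuous (locally constant factors)
  have hcont : Continuous f := by
    have h1 : Continuous fun x : GL (Fin n) F => Φ x :=
      (hΦ.1.comp_continuous Units.continuous_val).continuous
    have h2 : Continuous fun x : GL (Fin n) F => φ₀ (ρ (g₁ * x * g₂) v₀) :=
      ((ρ.isLocallyConstant_matrixCoeff φ₀ (hρ v₀)).comp_continuous
        ((continuous_const.mul continuous_id).mul continuous_const)).continuous
    have h3 : Continuous fun x : GL (Fin n) F =>
        ((((normAbs F ((Matrix.GeneralLinearGroup.det x : Fˣ) : F)) : ℝ≥0) : ℝ) : ℂ) ^ s :=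
      ((isLocallyConstant_normAbs_units.comp_continuous
        Matrix.GeneralLinearGroup.continuous_det).comp
          (fun a : ℝ≥0 => ((a : ℝ) : ℂ) ^ s)).continuous
    exact (h1.mul h2).mul h3
  refine ⟨hcont.aestronglyMeasurable, ?_⟩
  -- finiteness of the integral
  rw [hasFiniteIntegral_iff_enorm]
  calc ∫⁻ x, ‖f x‖ₑ ∂μ ≤ ∫⁻ x, ∑' d, (S d).indicator (fun _ => c d) x ∂μ := lintegral_mono hdom
    _ = ∑' d, ∫⁻ x, (S d).indicator (fun _ => c d) x ∂μ :=
        lintegral_tsum fun d => (measurable_const.indicator (hSmeas d)).aemeasurable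
    _ = ∑' d, c d * μ (S d) := by simp_rw [lintegral_indicator_const (hSmeas _)]
    _ ≤ ∑' d, ENNReal.ofReal K₀ * μ (glInt n F) * (ENNReal.ofReal (M * t ^ σ * Dc)) ^ d := by
        refine ENNReal.tsum_le_tsum fun d => ?_
        calc c d * μ (S d) ≤ c d * ((Dc : ℝ≥0∞) ^ d * μ (glInt n F)) := by gcongr; exact hμS d
          _ = ENNReal.ofReal K₀ * μ (glInt n F) * (ENNReal.ofReal (M * t ^ σ * Dc)) ^ d := by
              rw [hc]
              dsimp only
              rw [ENNReal.ofReal_mul hK₀0, ENNReal.ofReal_pow (mul_nonneg (zero_le_one.trans hM1)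
                htσ.le), ENNReal.ofReal_mul (mul_nonneg (zero_le_one.trans hM1) htσ.le),
                ENNReal.ofReal_natCast, mul_pow]
              ring
    _ = ENNReal.ofReal K₀ * μ (glInt n F) * ∑' d : ℕ, (ENNReal.ofReal (M * t ^ σ * Dc)) ^ d :=
        ENNReal.tsum_mul_left
    _ < ⊤ := by
        rw [ENNReal.tsum_geometric]
        refine ENNReal.mul_lt_top (ENNReal.mul_lt_top ENNReal.ofReal_lt_top hμK) ?_
        refine ENNReal.inv_lt_top.mpr (tsub_pos_iff_lt.mpr ?_)
        rw [ENNReal.ofReal_lt_one]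
        calc M * t ^ σ * Dc = M * Dc * t ^ σ := by ring
          _ < 1 := hq

end Integrability

/-! ### Cyclic vectors of irreducible representations and the discharge -/

section Final

open _root_.MeasureTheory _root_.Topology Filter
  Literature.NumberTheory.GaloisRepresentations.IsNonarchimedeanLocalField

/-- **Every non-zero vector of an irreducible representation is cyclic**: each `v` is a finite
linear combination `∑ c_g ρ(g) v₀` of translates of `v₀ ≠ 0` (the span of the orbit is a
non-zero subrepresentation). [folklore] -/
theorem exists_finsupp_sum_smul_apply_eq {k G V : Type*} [Field k] [Group G] [AddCommGroup V]
    [Module k V] (ρ : Representation k G V) [ρ.IsIrreducible] {v₀ : V} (hv₀ : v₀ ≠ 0) (v : V) :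
    ∃ c : G →₀ k, (c.sum fun g a => a • ρ g v₀) = v := by
  let W : Subrepresentation ρ :=
    ⟨Submodule.span k (Set.range fun g : G => ρ g v₀), fun g x hx => by
      refine (Submodule.span_mono ?_) (Submodule.mem_map_of_mem (f := ρ g) hx |>
        (Submodule.map_span (ρ g) _).le)
      rintro _ ⟨_, ⟨g', rfl⟩, rfl⟩
      exact ⟨g * g', by simp only [map_mul, Module.End.mul_apply]⟩⟩
  have hW : W = ⊤ := (eq_bot_or_eq_top W).resolve_left fun h => by
    have hmem : v₀ ∈ W := Submodule.subset_span ⟨1, by simp⟩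
    rw [h, Subrepresentation.mem_bot_iff] at hmem
    exact hv₀ hmem
  have hv : v ∈ Submodule.span k (Set.range fun g : G => ρ g v₀) := by
    change v ∈ W
    rw [hW]
    exact Subrepresentation.mem_top' v
  exact Finsupp.mem_span_range_iff_exists_finsupp.mp hv

variable {F : Type} [Field F] [ValuativeRel F] [TopologicalSpace F] [IsNonarchimedeanLocalField F]
  {n : ℕ}

/-- **Godement–Jacquet (1972), Thm. 3.3 (1): convergence of the local zeta integrals**
(discharge of `GodementJacquet1972_local_convergence`). For an irreducible admissible
representation `π` of `GL_n(F)` over a non-archimedean local field and a Haar measure `μG`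
there is `s₀` such that `Z(Φ, s, f) = ∫ Φ(x) f(x) |det x|^s dμG` converges absolutely for all
`Φ ∈ 𝒮(M_n(F))`, all coefficients `f(g) = ⟨π(g) v, ṽ⟩` (`ṽ ∈ Ṽ`, `v ∈ V`) and `re s > s₀`.

Proof (elementary, through the Hecke algebra of a principal congruence subgroup rather than the
printed route through supercuspidal supports): fix `v₀ ≠ 0` of level `K_m` (`m ≥ 2`) and a
`K_m`-fixed `ṽ₀ ∈ Ṽ`; by irreducibility of `V` and of `Ṽ`
(`Representation.isIrreducible_contragredient_holds`, with `GL_n(F)` nonarchimedean, locally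
compact, Hausdorff) every coefficient is a finite combination of two-sided translates
`x ↦ ⟨π(h⁻¹ x g) v₀, ṽ₀⟩`, and each of these is integrable against `Φ |det|^s` for
`re s > s₀(v₀, ṽ₀)` by `exists_integrable_coeff_translate` (Cartan decomposition, exponential
growth of coefficients from Hecke multiplicativity at level `K_m`, and the coset count
`#(Δ_d K/K) ≤ D^d`). (Godement–Jacquet, LNM 260 (1972), Thm. 3.3 (1); Jacquet, Corvallis (1979),
Part 2, Prop. (1.2)(1).) [cite: GodementJacquet1972, Thm. 3.3 (1)] -/
theorem GodementJacquet1972_local_convergence_holds :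
    GodementJacquet1972_local_convergence (F := F) (n := n) := by
  intro _ _ μG _ V _ _ ρ _ hρ
  classical
  -- topological instances on `GL_n(F)`
  haveI : T2Space F := t2Space_of_isNonarchimedeanLocalField
  haveI : NonarchimedeanGroup (GL (Fin n) F) := nonarchimedeanGroup_gl F n
  haveI : LocallyCompactSpace (Matrix (Fin n) (Fin n) F) :=
    inferInstanceAs (LocallyCompactSpace (Fin n → Fin n → F))
  haveI : LocallyCompactSpace (GL (Fin n) F) := inferInstance
  -- a uniformizer, a non-zero vector `v₀` and its level `K_m`, `m ≥ 2`
  obtain ⟨ϖ, hϖ⟩ := exists_isUniformizingElement (F := F)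
  haveI : Nontrivial V := Representation.IsIrreducible.nontrivial ρ
  obtain ⟨v₀, hv₀0⟩ := exists_ne (0 : V)
  obtain ⟨m₀, -, hsub⟩ := exists_congruenceGL_pow_subset hϖ
    ((hρ.1 v₀).mem_nhds ((ρ.stabilizerSubgroup v₀).one_mem))
  set m : ℕ := m₀ + 2 with hmdef
  have hm : 2 ≤ m := by omega
  set Km : Subgroup (GL (Fin n) F) := congruenceGL n (valuation F ϖ ^ m) with hKm
  have hle : Km ≤ congruenceGL n (valuation F ϖ ^ m₀) :=
    congruenceGL_mono (pow_le_pow_right_of_le_one' hϖ.valuation_le_one (by omega))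
  have hv₀ : v₀ ∈ ρ.fixedPoints Km :=
    (ρ.mem_fixedPoints Km v₀).2 fun g hg => hsub (hle hg)
  have hc0 : valuation F ϖ ^ m ≠ 0 := pow_ne_zero _ ((Valuation.ne_zero_iff _).mpr hϖ.ne_zero)
  have hKo : IsOpen (Km : Set (GL (Fin n) F)) := isOpen_congruenceGL hc0
  have hKc : IsCompact (Km : Set (GL (Fin n) F)) := isCompact_congruenceGL _
  haveI : Module.Finite ℂ (ρ.fixedPoints Km) := hρ.2 ⟨Km, hKo⟩ hKc
  -- a `K_m`-fixed smooth linear form `φ₀` with `φ₀ v₀ ≠ 0`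
  obtain ⟨φ₀, hφ₀, hφ₀K, hφ₀v⟩ :=
    hρ.1.exists_mem_contragredient_apply_ne_zero_of_mem_fixedPoints hKo hKc hv₀ hv₀0
  -- the core estimate for the coefficient `⟨π(·) v₀, φ₀⟩`
  obtain ⟨s₀, hs₀⟩ := exists_integrable_coeff_translate hϖ hm ρ hρ.1 hv₀ hφ₀ hφ₀K μG
  refine ⟨s₀, fun Φ hΦ φ hφ v s hs => ?_⟩
  -- `v` and `φ` are finite combinations of translates of `v₀`, `φ₀`
  obtain ⟨c, hc⟩ := exists_finsupp_sum_smul_apply_eq ρ hv₀0 v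
  have hirr : ρ.contragredientRep.IsIrreducible := Representation.isIrreducible_contragredient_holds ρ hρ
  have hΦ₀0 : (⟨φ₀, hφ₀⟩ : ρ.Contragredient) ≠ 0 := fun h => by
    have : φ₀ = 0 := congrArg (Representation.Contragredient.subtype ρ) h
    exact hφ₀v (by rw [this, LinearMap.zero_apply])
  obtain ⟨d, hd⟩ := exists_finsupp_sum_smul_apply_eq ρ.contragredientRep hΦ₀0 ⟨φ, hφ⟩
  have hv : v = ∑ g ∈ c.support, c g • ρ g v₀ := by rw [← hc]; rfl
  have hφ' : φ = ∑ h ∈ d.support, d h • ρ.dual h φ₀ := by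
    have := congrArg (Representation.Contragredient.subtype ρ) hd
    rw [Finsupp.sum, map_sum] at this
    rw [← show Representation.Contragredient.subtype ρ ⟨φ, hφ⟩ = φ from rfl, ← this]
    refine Finset.sum_congr rfl fun h _ => ?_
    rw [map_smul, Representation.subtype_contragredientRep_apply]
    rfl
  -- expand the coefficient and the integrand
  have key : ∀ x : GL (Fin n) F, φ (ρ x v) =
      ∑ h ∈ d.support, ∑ g ∈ c.support, d h * c g * φ₀ (ρ (h⁻¹ * x * g) v₀) := by
    intro x
    rw [hv, hφ', LinearMap.sum_apply]
    refine Finset.sum_congr rfl fun h _ => ?_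
    rw [LinearMap.smul_apply, map_sum, map_sum, smul_eq_mul, Finset.mul_sum]
    refine Finset.sum_congr rfl fun g _ => ?_
    rw [map_smul, map_smul, smul_eq_mul]
    simp only [Representation.dual_apply, Module.Dual.transpose_apply, LinearMap.comp_apply,
      map_mul, Module.End.mul_apply]
    ring
  have hexp : gjLocalIntegrand Φ (ρ.matrixCoeff φ v) s = fun x : GL (Fin n) F =>
      ∑ h ∈ d.support, ∑ g ∈ c.support, (d h * c g) * (Φ x * φ₀ (ρ (h⁻¹ * x * g) v₀) *
        ((((normAbs F ((Matrix.GeneralLinearGroup.det x : Fˣ) : F)) : ℝ≥0) : ℝ) : ℂ) ^ s) := by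
    funext x
    simp only [gjLocalIntegrand, Representation.matrixCoeff_apply]
    rw [key x, Finset.mul_sum, Finset.sum_mul]
    refine Finset.sum_congr rfl fun h _ => ?_
    rw [Finset.mul_sum, Finset.sum_mul]
    refine Finset.sum_congr rfl fun g _ => ?_
    ring
  rw [hexp]
  refine integrable_finsetSum _ fun h _ => integrable_finsetSum _ fun g _ => ?_
  exact (hs₀ h⁻¹ g Φ hΦ s hs).const_mul _

end Final

end Literature.NumberTheory.Automorphic
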